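import Summits.AtomisticToContinuum.HydrodynamicLimit.Theses.ImplosionDichotomy
import Summits.AtomisticToContinuum.HydrodynamicLimit.Theorems.ImplosionDichotomyPolynomialCompressionIdealGasBridgeCalculus
import Summits.AtomisticToContinuum.HydrodynamicLimit.Theorems.ImplosionDichotomyPolynomialCompressionStaticsLLN
import Summits.AtomisticToContinuum.HydrodynamicLimit.Theorems.ImplosionDichotomyPolynomialCompressionStaticsSmoothRate
import Summits.AtomisticToContinuum.HydrodynamicLimit.Theorems.ImplosionDichotomyHsEosLowDensity
import Summits.AtomisticToContinuum.HydrodynamicLimit.Theorems.ImplosionDichotomyEosContinuity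

/-!
# `ImplosionDichotomy.ImplosionUnboundedDensity` — the glue over the implosion and the
# equation-of-state continuity, and its reduction to the vendored implosion theorem

Route support item stmt-AtomisticToContinuum-12590 (`ImplosionUnboundedDensity`, route
`ImplosionDichotomy` of `AtomisticToContinuum/HydrodynamicLimit`): there are continuous positive
profiles `(a₀, u₀, θ₀)` such that for every level `M` there is `σ₀ > 0` with: for all
`0 < σ < σ₀` an ADMISSIBLE classical hard-sphere-Euler solution (its `t = 0` fields are the law of
large numbers limit of the local Gibbs laws, through every hard-sphere flow family) exists whose
density is `≥ M` somewhere on its interval of classical existence.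

The item is filed as GLUE over the two route supports
`IdealGasImplosion` (stmt-12588: a classical solution of the `σ = 0` system — the monatomic ideal
gas — from data `(a₀/∫a₀, u₀, θ₀)` with unbounded density on `[0, T₁)`; Cao-Labora–Gómez-Serrano–
Shi–Staffilani 2025, Thm 1.2 + Rem 1.4–1.5, with the Buckmaster–Cao-Labora–Gómez-Serrano `γ = 5/3`
profile) and `EosContinuity` (stmt-12589: existence of admissible classical solutions of the
`σ`-system beyond any `T₂ < T₁` and their `ε`-closeness to the ideal solution on `[0, T₂]`, for
`σ` small; Kato 1975 / Majda 1984 continuous dependence along the one-parameter family of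
equations of state `p_σ = ρ θ Z(ρσ³)`). This file proves:

* `implosionUnboundedDensity_of_tracking` — the glue from its MINIMAL input: profiles, an ideal
  (`σ = 0`) classical solution `ρ₁` with unbounded density on `[0, T₁)`, and the TRACKING property
  "for every `T₂ < T₁` and `ε > 0`, for all small `σ` SOME admissible classical `σ`-solution exists
  beyond `T₂` and is `ε`-close to `ρ₁` in density on `[0, T₂]`" (no uniqueness clause);
* `implosionUnboundedDensity_of` — `IdealGasImplosion → EosContinuity → ImplosionUnboundedDensity`
  (the planner's glue: for `M` take `t_M < T₁` with `ρ₁(t_M, x_M) ≥ M + 1`, `T₂ := (t_M + T₁)/2`,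
  `ε := 1`);
* `exists_idealGasImplosion_of_thm12`, `implosionUnboundedDensity_of_thm12` — the ideal-gas
  input from the vendored named fact `Literature.Analysis.FluidPDE.CaolaboraEtAl2025_thm12_euler (5/3)`
  (via the landed `exists_smooth_isentropic_idealGasImplosion_of_thm12`; the route decl
  `IdealGasImplosion` itself is recorded conditionally in `…Theorems.ImplosionDichotomyIdealGasImplosion`),
  hence
  `CaolaboraEtAl2025_thm12_euler (5/3) → EosContinuity → ImplosionUnboundedDensity`: conditional on
  ONE published theorem, the item is reduced to the route support `EosContinuity` (stmt-12589),
  whose analytic content (local well-posedness and continuous dependence in `H^s(𝕋³)` for the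
  symmetrisable hyperbolic hard-sphere Euler system) is not in the tree;
* `tendstoHydroFieldsAt_congr_slice` — the law of large numbers at time `t` only sees the time-`t`
  slices of the fields;
* `implosionUnboundedDensity_of_pdeTracking`, `implosionUnboundedDensity_of_thm12_of_pde` — the
  STATICS DISCHARGED: by the landed identified law of large numbers `stub_staticsLLN` (the tree's
  `localGibbs_lln_holds` with the limit density exposed as the explicit cluster series
  `rhoLim (profileOf a₀) σ`), admissibility of a classical `σ`-solution is implied by its having the
  PRESCRIBED data `(rhoLim (profileOf a₀) σ, u₀, θ₀)`; so the item follows from the named fact and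
  the purely PDE tracking statement "for small `σ` a classical `σ`-solution with these data exists
  beyond `T₂` and is `ε`-close in density to the ideal solution on `[0, T₂]`" — `EosContinuity`
  clause (i) with its data made explicit plus closeness of THAT solution, no uniqueness clause;
* `implosionUnboundedDensity_of_logLipschitzStubs` — the item from the three OPEN registered stubs
  (`stub_typeOneImplosion`, `stub_conditionalExistence`, `stub_logBudgetShadowing`, verbatim as
  hypotheses) of the line `log-lipschitz-budget` of the neighbouring crux `PolynomialCompression`
  (stmt-12587), all of whose other inputs are landed (`hsEosLowDensity_proof`, `stub_staticsLLN`,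
  `stub_staticsSmoothRate`): that line's stubs quantify over ALL small `σ`, so they give the
  `∃ σ₀ ∀ σ < σ₀` shape of this item (exit time `T₁ - σ^e`, density `≥ (c/2) σ^{-eβ}`).
-/

namespace Summit.AtomisticToContinuum.HydrodynamicLimit.Theorems

open Set MeasureTheory
open Literature.MathematicalPhysics.KineticTheory Literature.Analysis.FunctionSpaces
open Summit.AtomisticToContinuum.HydrodynamicLimit.Theses.ImplosionDichotomy

/-- **Glue from the minimal tracking input.** Let `(a₀, u₀, θ₀)` be continuous positive profiles
and `ρ₁` a density field, unbounded on `[0, T₁)` (`∀ M, ∃ t ∈ [0, T₁), ∃ x, M ≤ ρ₁ t x`). Assume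
TRACKING: for every `0 < T₂ < T₁` and `ε > 0` there is `σ₀ > 0` such that for `0 < σ < σ₀` some
classical hard-sphere-Euler solution `(ρ, u, θ)` on `[0, T)`, `T > T₂`, admissible for the local
Gibbs laws of `(a₀, u₀, θ₀)` at reduced diameter `σ`, satisfies `|ρ t x - ρ₁ t x| < ε` for
`t ∈ [0, T)`, `t ≤ T₂`. Then `ImplosionUnboundedDensity` holds with these profiles: given `M`, pick
`t_M ∈ [0, T₁)`, `x_M` with `M + 1 ≤ ρ₁ t_M x_M`, track up to `T₂ := (t_M + T₁)/2` with `ε := 1`,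
and read off `ρ t_M x_M > ρ₁ t_M x_M - 1 ≥ M`. [folklore] -/
theorem implosionUnboundedDensity_of_tracking {a₀ θ₀ : T3 → ℝ} {u₀ : T3 → V3}
    (ha : Continuous a₀) (hθ : Continuous θ₀) (hu : Continuous u₀) (ha0 : ∀ x, 0 < a₀ x)
    (hθ0 : ∀ x, 0 < θ₀ x) {T₁ : ℝ} {ρ₁ : ℝ → T3 → ℝ}
    (hunb : ∀ M : ℝ, ∃ t ∈ Ico 0 T₁, ∃ x, M ≤ ρ₁ t x)
    (htrack : ∀ T₂ : ℝ, 0 < T₂ → T₂ < T₁ → ∀ ε : ℝ, 0 < ε → ∃ σ₀ : ℝ, 0 < σ₀ ∧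
      ∀ σ : ℝ, 0 < σ → σ < σ₀ → ∃ (T : ℝ) (ρ θ : ℝ → T3 → ℝ) (u : ℝ → T3 → V3), T₂ < T ∧
        IsHardSphereEulerSolution σ T ρ u θ ∧
        (∀ Φ : (N : ℕ) → Literature.Analysis.FluidPDE.HardSphereFlow
            (Literature.Analysis.FluidPDE.Torus.geometry (Fin 3)) (hsDiameter σ N) (N + 1),
          TendstoHydroFieldsAt (fun N => localGibbsLaw σ a₀ u₀ θ₀ N (Φ N)) Φ ρ u θ 0) ∧
        ∀ t ∈ Ico 0 T, t ≤ T₂ → ∀ x, |ρ t x - ρ₁ t x| < ε) :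
    ImplosionUnboundedDensity := by
  refine ⟨a₀, θ₀, u₀, ha, hθ, hu, ha0, hθ0, fun M => ?_⟩
  obtain ⟨tM, htM, xM, hM⟩ := hunb (M + 1)
  have htT₂ : tM < (tM + T₁) / 2 := by linarith [htM.2]
  have hT₂0 : 0 < (tM + T₁) / 2 := lt_of_le_of_lt htM.1 htT₂
  have hT₂1 : (tM + T₁) / 2 < T₁ := by linarith [htM.2]
  obtain ⟨σ₀, hσ₀, H⟩ := htrack ((tM + T₁) / 2) hT₂0 hT₂1 1 one_pos
  refine ⟨σ₀, hσ₀, fun σ hσ hσlt => ?_⟩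
  obtain ⟨T, ρ, θ, u, hT, hsolσ, htie, hclose⟩ := H σ hσ hσlt
  have htMT : tM ∈ Ico 0 T := ⟨htM.1, htT₂.trans hT⟩
  refine ⟨T, ρ, θ, u, hsolσ, htie, tM, htMT, xM, ?_⟩
  have h := (abs_lt.1 (hclose tM htMT htT₂.le xM)).1
  linarith

/-- **The planner's glue**: `IdealGasImplosion → EosContinuity → ImplosionUnboundedDensity`
(route `ImplosionDichotomy`, supports stmt-12588 and stmt-12589 ⟹ stmt-12590). The profiles are
those of the ideal-gas implosion; `EosContinuity`, applied to its `σ = 0` solution, supplies the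
tracking input of `implosionUnboundedDensity_of_tracking` (its existence clause (i) together with
its closeness clause (ii) specialised to the solution produced by (i)). [folklore] -/
theorem implosionUnboundedDensity_of (hI : IdealGasImplosion) (hE : EosContinuity) :
    ImplosionUnboundedDensity := by
  obtain ⟨a₀, θ₀, u₀, ha, hθ, hu, ha0, hθ0, T₁, ρ₁, θ₁, u₁, -, hsol, hρd, hud, hθd, hunb⟩ := hI
  refine implosionUnboundedDensity_of_tracking ha hθ hu ha0 hθ0 hunb fun T₂ hT₂0 hT₂1 ε hε => ?_
  obtain ⟨σ₀, hσ₀, H⟩ :=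
    hE a₀ θ₀ u₀ ha hθ hu ha0 hθ0 T₁ ρ₁ θ₁ u₁ hsol hρd hud hθd T₂ hT₂0 hT₂1 ε hε
  refine ⟨σ₀, hσ₀, fun σ hσ hσlt => ?_⟩
  obtain ⟨⟨T, ρ, θ, u, hT, hsolσ, htie⟩, hclose⟩ := H σ hσ hσlt
  exact ⟨T, ρ, θ, u, hT, hsolσ, htie, hclose T ρ θ u hsolσ htie⟩

/-- **The ideal-gas input from the vendored implosion theorem** (the clauses of
`IdealGasImplosion`, from the landed `exists_smooth_isentropic_idealGasImplosion_of_thm12` by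
forgetting smoothness and isentropy; the route decl itself is recorded conditionally on the same
fact in `…Theorems.ImplosionDichotomyIdealGasImplosion`): continuous positive profiles and a
classical `σ = 0` solution on `[0, T₁)`, `T₁ > 0`, with data `(a₀/∫a₀, u₀, θ₀)` and unbounded
density. [cite: CaolaboraEtAl2025, Thm 1.2 + Rem 1.4 + Rem 1.5] -/
theorem exists_idealGasImplosion_of_thm12
    (hfact : Literature.Analysis.FluidPDE.CaolaboraEtAl2025_thm12_euler (5 / 3)) :
    ∃ (a₀ θ₀ : T3 → ℝ) (u₀ : T3 → V3), Continuous a₀ ∧ Continuous θ₀ ∧ Continuous u₀ ∧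
      (∀ x, 0 < a₀ x) ∧ (∀ x, 0 < θ₀ x) ∧
      ∃ (T₁ : ℝ) (ρ₁ θ₁ : ℝ → T3 → ℝ) (u₁ : ℝ → T3 → V3), 0 < T₁ ∧
        IsHardSphereEulerSolution 0 T₁ ρ₁ u₁ θ₁ ∧ (∀ x, ρ₁ 0 x = a₀ x / ∫ y, a₀ y) ∧
        u₁ 0 = u₀ ∧ θ₁ 0 = θ₀ ∧ ∀ M : ℝ, ∃ t ∈ Ico 0 T₁, ∃ x, M ≤ ρ₁ t x := by
  obtain ⟨a₀, θ₀, u₀, ha, hθ, hu, ha0, hθ0, T₁, -, ρ₁, θ₁, u₁, hT₁, -, hsol, hρd, hud, hθd, -,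
    hunb⟩ := exists_smooth_isentropic_idealGasImplosion_of_thm12 hfact
  exact ⟨a₀, θ₀, u₀, ha.continuous, hθ.continuous, hu.continuous, ha0, hθ0, T₁, ρ₁, θ₁, u₁, hT₁,
    hsol, hρd, hud, hθd, hunb⟩

/-- **`ImplosionUnboundedDensity` reduced to `EosContinuity`, conditional on one published
theorem**: `CaolaboraEtAl2025_thm12_euler (5/3) → EosContinuity → ImplosionUnboundedDensity`
(`exists_idealGasImplosion_of_thm12` fed into the glue `implosionUnboundedDensity_of`).
[cite: CaolaboraEtAl2025, Thm 1.2 + Rem 1.4 + Rem 1.5] -/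
theorem implosionUnboundedDensity_of_thm12
    (hfact : Literature.Analysis.FluidPDE.CaolaboraEtAl2025_thm12_euler (5 / 3))
    (hE : EosContinuity) : ImplosionUnboundedDensity := by
  obtain ⟨a₀, θ₀, u₀, ha, hθ, hu, ha0, hθ0, T₁, ρ₁, θ₁, u₁, hT₁, hsol, hρd, hud, hθd, hunb⟩ :=
    exists_idealGasImplosion_of_thm12 hfact
  exact implosionUnboundedDensity_of
    ⟨a₀, θ₀, u₀, ha, hθ, hu, ha0, hθ0, T₁, ρ₁, θ₁, u₁, hT₁, hsol, hρd, hud, hθd, hunb⟩ hE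

/-! ## Discharging the statics: admissibility from prescribed data -/

/-- **The law of large numbers at time `t` only sees the time-`t` slices**: field families with the
same slices `ρ t`, `u t`, `θ t` satisfy `TendstoHydroFieldsAt … t` simultaneously (the definition
mentions the fields only through `ρ t x`, `u t x`, `θ t x`). [folklore] -/
theorem tendstoHydroFieldsAt_congr_slice {ε : ℕ → ℝ}
    {P : (N : ℕ) → Measure (Literature.Analysis.FluidPDE.Config (N + 1) (Fin 3) T3)}
    {Φ : (N : ℕ) → Literature.Analysis.FluidPDE.HardSphereFlow
      (Literature.Analysis.FluidPDE.Torus.geometry (Fin 3)) (ε N) (N + 1)}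
    {ρ ρ' θ θ' : ℝ → T3 → ℝ} {u u' : ℝ → T3 → V3} {t : ℝ}
    (hρ : ρ t = ρ' t) (hu : u t = u' t) (hθ : θ t = θ' t) :
    TendstoHydroFieldsAt P Φ ρ u θ t ↔ TendstoHydroFieldsAt P Φ ρ' u' θ' t := by
  unfold TendstoHydroFieldsAt
  simp only [hρ, hu, hθ]

/-- **Glue with the statics discharged.** Let `(a₀, u₀, θ₀)` be continuous positive profiles and
`ρ₁` a density field unbounded on `[0, T₁)`. Assume the PDE tracking statement with PRESCRIBED
data: for every `0 < T₂ < T₁` and `ε > 0` there is `σ₀ > 0` such that for `0 < σ < σ₀` a classical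
hard-sphere-Euler solution `(ρ, u, θ)` on `[0, T)`, `T > T₂`, with data
`(rhoLim (profileOf a₀) σ, u₀, θ₀)` — the explicit cluster-series limit density of the local Gibbs
laws — exists and satisfies `|ρ t x - ρ₁ t x| < ε` for `t ∈ [0, T)`, `t ≤ T₂`. Then
`ImplosionUnboundedDensity`: below the statics threshold `σ₁(a₀, θ₀, u₀)` of `stub_staticsLLN`
such a solution is admissible (the `t = 0` tie holds through every flow family, by
`tendstoHydroFieldsAt_congr_slice`), and `implosionUnboundedDensity_of_tracking` applies with
`min σ₀ σ₁`. [folklore] -/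
theorem implosionUnboundedDensity_of_pdeTracking {a₀ θ₀ : T3 → ℝ} {u₀ : T3 → V3}
    (ha : Continuous a₀) (hθ : Continuous θ₀) (hu : Continuous u₀) (ha0 : ∀ x, 0 < a₀ x)
    (hθ0 : ∀ x, 0 < θ₀ x) {T₁ : ℝ} {ρ₁ : ℝ → T3 → ℝ}
    (hunb : ∀ M : ℝ, ∃ t ∈ Ico 0 T₁, ∃ x, M ≤ ρ₁ t x)
    (hpde : ∀ T₂ : ℝ, 0 < T₂ → T₂ < T₁ → ∀ ε : ℝ, 0 < ε → ∃ σ₀ : ℝ, 0 < σ₀ ∧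
      ∀ σ : ℝ, 0 < σ → σ < σ₀ → ∃ (T : ℝ) (ρ θ : ℝ → T3 → ℝ) (u : ℝ → T3 → V3), T₂ < T ∧
        IsHardSphereEulerSolution σ T ρ u θ ∧
        ρ 0 = rhoLim (profileOf a₀ ha ha0) σ ∧ u 0 = u₀ ∧ θ 0 = θ₀ ∧
        ∀ t ∈ Ico 0 T, t ≤ T₂ → ∀ x, |ρ t x - ρ₁ t x| < ε) :
    ImplosionUnboundedDensity := by
  obtain ⟨σ₁, hσ₁, hstat⟩ := stub_staticsLLN a₀ θ₀ u₀ ha hθ hu ha0 hθ0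
  refine implosionUnboundedDensity_of_tracking ha hθ hu ha0 hθ0 hunb fun T₂ hT₂0 hT₂1 ε hε => ?_
  obtain ⟨σ₀, hσ₀, H⟩ := hpde T₂ hT₂0 hT₂1 ε hε
  refine ⟨min σ₀ σ₁, lt_min hσ₀ hσ₁, fun σ hσ hσlt => ?_⟩
  obtain ⟨T, ρ, θ, u, hT, hsol, hρ0, hu0, hθ0', hclose⟩ :=
    H σ hσ (lt_of_lt_of_le hσlt (min_le_left _ _))
  obtain ⟨-, -, hlln⟩ := hstat σ hσ (lt_of_lt_of_le hσlt (min_le_right _ _))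
  exact ⟨T, ρ, θ, u, hT, hsol,
    fun Φ => (tendstoHydroFieldsAt_congr_slice hρ0 hu0 hθ0').2 (hlln Φ), hclose⟩

/-- **`ImplosionUnboundedDensity` from the vendored implosion theorem and pure PDE tracking.**
Assuming `CaolaboraEtAl2025_thm12_euler (5/3)` and the PDE statement "for all continuous positive
profiles `(a₀, u₀, θ₀)` and every classical `σ = 0` solution `(ρ₁, u₁, θ₁)` on `[0, T₁)` with data
`(a₀/∫a₀, u₀, θ₀)`: for every `0 < T₂ < T₁`, `ε > 0` and all small `σ`, a classical solution of
the `σ`-system on some `[0, T)`, `T > T₂`, with data `(rhoLim (profileOf a₀) σ, u₀, θ₀)` exists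
and is `ε`-close to `ρ₁` in density on `[0, T₂]`" (`EosContinuity` (i) with its admissible data
made explicit, plus closeness of that solution — Kato 1975 / Majda 1984 continuous dependence for
the symmetrisable hard-sphere Euler system along `p_σ = ρθZ(ρσ³) → ρθ`, with the data
`rhoLim (profileOf a₀) σ → a₀/∫a₀`), `ImplosionUnboundedDensity` holds: the statics are discharged
by the tree (`implosionUnboundedDensity_of_pdeTracking`), the implosion by the named fact
(`exists_idealGasImplosion_of_thm12`). [cite: CaolaboraEtAl2025, Thm 1.2 + Rem 1.4 + Rem 1.5] -/
theorem implosionUnboundedDensity_of_thm12_of_pde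
    (hfact : Literature.Analysis.FluidPDE.CaolaboraEtAl2025_thm12_euler (5 / 3))
    (hpde : ∀ (a₀ θ₀ : T3 → ℝ) (u₀ : T3 → V3) (ha : Continuous a₀), Continuous θ₀ →
      Continuous u₀ → ∀ (ha0 : ∀ x, 0 < a₀ x), (∀ x, 0 < θ₀ x) →
      ∀ (T₁ : ℝ) (ρ₁ θ₁ : ℝ → T3 → ℝ) (u₁ : ℝ → T3 → V3),
        IsHardSphereEulerSolution 0 T₁ ρ₁ u₁ θ₁ → (∀ x, ρ₁ 0 x = a₀ x / ∫ y, a₀ y) →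
        u₁ 0 = u₀ → θ₁ 0 = θ₀ →
        ∀ T₂ : ℝ, 0 < T₂ → T₂ < T₁ → ∀ ε : ℝ, 0 < ε → ∃ σ₀ : ℝ, 0 < σ₀ ∧
          ∀ σ : ℝ, 0 < σ → σ < σ₀ → ∃ (T : ℝ) (ρ θ : ℝ → T3 → ℝ) (u : ℝ → T3 → V3), T₂ < T ∧
            IsHardSphereEulerSolution σ T ρ u θ ∧
            ρ 0 = rhoLim (profileOf a₀ ha ha0) σ ∧ u 0 = u₀ ∧ θ 0 = θ₀ ∧
            ∀ t ∈ Ico 0 T, t ≤ T₂ → ∀ x, |ρ t x - ρ₁ t x| < ε) :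
    ImplosionUnboundedDensity := by
  obtain ⟨a₀, θ₀, u₀, ha, hθ, hu, ha0, hθ0, T₁, ρ₁, θ₁, u₁, -, hsol, hρd, hud, hθd, hunb⟩ :=
    exists_idealGasImplosion_of_thm12 hfact
  exact implosionUnboundedDensity_of_pdeTracking ha hθ hu ha0 hθ0 hunb
    (hpde a₀ θ₀ u₀ ha hθ hu ha0 hθ0 T₁ ρ₁ θ₁ u₁ hsol hρd hud hθd)


/-! ## The item from the registered stubs of the line `log-lipschitz-budget` (crux `PolynomialCompression`) -/

/-- **`ImplosionUnboundedDensity` from the three open stubs of the line `log-lipschitz-budget`** of the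
crux `ImplosionDichotomy.PolynomialCompression` (stmt-12587; skeleton
`Cruxes/PolynomialCompression/Lines/log-lipschitz-budget.lean`, statements VERBATIM as registered on
2026-08-16): `stub_typeOneImplosion` (h1: a Type-I ideal-gas implosion with core density
`≥ c (T₁ - t)^{-β}`), `stub_conditionalExistence` (h3: Kato/Majda classical existence on a prescribed
horizon from a-priori bounds) and `stub_logBudgetShadowing` (h4: the a-priori state/`C¹` bounds and the
shadowing inequality `ρ₁ ≤ 2ρ` up to `T₁ - σ^e/2`, for EVERY `σ < σ₂`). The remaining inputs of that
line are landed theorems used here by name: the equation of state `hsEosLowDensity_proof` (stmt-0768),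
the identified law of large numbers `stub_staticsLLN` and the smooth statics rate
`stub_staticsSmoothRate` (witness `ρ₀^σ = rhoLim (profileOf a₀) σ`). Bookkeeping: given `M`, put
`M' = max M 1`, `m = c/(2M')` and `σ₀ = min σ₂ m^{1/(eβ)}`; for `σ < σ₀` the classical solution with
the statics data exists on `[0, T₁ - σ^e/2)` (h3 with the bounds of h4), is admissible
(`tendstoHydroFieldsAt_congr_slice`), and at the exit time `tₑ = T₁ - σ^e` its density is
`≥ ρ₁/2 ≥ (c/2) σ^{-eβ} > (c/2)/m = M' ≥ M`. So the line that proves `PolynomialCompression` proves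
this item as well (its stubs quantify over all small `σ`, which the `∃ σ₀ ∀ σ < σ₀` shape of
`ImplosionUnboundedDensity` needs and the `∀ σ₀ ∃ σ < σ₀` shape of `PolynomialCompression` does not).
[folklore] -/
theorem implosionUnboundedDensity_of_logLipschitzStubs
    (h1 :
      ∃ (a₀ θ₀ : T3 → ℝ) (u₀ : T3 → V3), Torus.IsSmooth a₀ ∧ Torus.IsSmooth θ₀ ∧ Torus.IsSmooth u₀ ∧
        (∀ x, 0 < a₀ x) ∧ (∀ x, 0 < θ₀ x) ∧
        ∃ (T₁ K : ℝ) (ρ₁ θ₁ : ℝ → T3 → ℝ) (u₁ : ℝ → T3 → V3), 0 < T₁ ∧ 0 < K ∧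
          IsHardSphereEulerSolution 0 T₁ ρ₁ u₁ θ₁ ∧
          (∀ x, ρ₁ 0 x = a₀ x / ∫ y, a₀ y) ∧ u₁ 0 = u₀ ∧ θ₁ 0 = θ₀ ∧
          (∀ t ∈ Ico 0 T₁, ∀ x, θ₁ t x = K * ρ₁ t x ^ (2 / 3 : ℝ)) ∧
          (∃ C : ℝ, ∀ t ∈ Ico 0 T₁, ∀ x, ∀ i : Fin 3,
              ‖Torus.partialDeriv i (u₁ t) x‖ ≤ C / (T₁ - t) ∧
              |Torus.partialDeriv i (fun y => ρ₁ t y ^ (1 / 3 : ℝ)) x| ≤ C / (T₁ - t)) ∧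
          (∀ n : ℕ, n ≤ 6 → ∃ Cn pn : ℝ, ∀ t ∈ Ico 0 T₁, ∀ y : EuclideanSpace ℝ (Fin 3),
              ‖iteratedFDeriv ℝ n (Torus.lift (ρ₁ t)) y‖ ≤ Cn * (T₁ - t) ^ (-pn) ∧
              ‖iteratedFDeriv ℝ n (Torus.lift (u₁ t)) y‖ ≤ Cn * (T₁ - t) ^ (-pn)) ∧
          (∃ cl pl : ℝ, 0 < cl ∧ ∀ t ∈ Ico 0 T₁, ∀ x, cl * (T₁ - t) ^ pl ≤ ρ₁ t x) ∧
          ∃ β c : ℝ, 0 < β ∧ 0 < c ∧ ∀ t ∈ Ico 0 T₁, ∃ x, c * (T₁ - t) ^ (-β) ≤ ρ₁ t x)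
    (h3 :
      ∀ η₀ : ℝ, 0 < η₀ → ∀ F : ℝ → ℝ, AnalyticOnNhd ℝ F (Ioo (-η₀) η₀) →
        EqOn hsExcessFreeEnergy F (Ico 0 η₀) → F 0 = 0 → deriv F 0 = 2 * Real.pi / 3 →
        ∃ η₁ : ℝ, 0 < η₁ ∧ ∀ σ : ℝ, 0 < σ →
          ∀ (ρ₀ θ₀ : T3 → ℝ) (u₀ : T3 → V3), Torus.IsSmooth ρ₀ → Torus.IsSmooth θ₀ → Torus.IsSmooth u₀ →
            (∀ x, 0 < ρ₀ x) → (∀ x, 0 < θ₀ x) → (∀ x, ρ₀ x * σ ^ 3 ≤ η₁) →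
            ∀ T' M : ℝ, 0 < T' → 0 < M →
              (∀ T : ℝ, T ≤ T' → ∀ (ρ θ : ℝ → T3 → ℝ) (u : ℝ → T3 → V3),
                  IsHardSphereEulerSolution σ T ρ u θ → ρ 0 = ρ₀ → u 0 = u₀ → θ 0 = θ₀ →
                  ∀ t ∈ Ico 0 T, ∀ x,
                    M⁻¹ ≤ ρ t x ∧ ρ t x ≤ M ∧ M⁻¹ ≤ θ t x ∧ θ t x ≤ M ∧ ‖u t x‖ ≤ M ∧
                    ρ t x * σ ^ 3 ≤ η₁ ∧
                    ∀ i : Fin 3, ‖Torus.partialDeriv i (u t) x‖ ≤ M ∧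
                      |Torus.partialDeriv i (ρ t) x| ≤ M ∧ |Torus.partialDeriv i (θ t) x| ≤ M) →
              ∃ (ρ θ : ℝ → T3 → ℝ) (u : ℝ → T3 → V3),
                IsHardSphereEulerSolution σ T' ρ u θ ∧ ρ 0 = ρ₀ ∧ u 0 = u₀ ∧ θ 0 = θ₀)
    (h4 :
      ∀ η₀ : ℝ, 0 < η₀ → ∀ F : ℝ → ℝ, AnalyticOnNhd ℝ F (Ioo (-η₀) η₀) →
        EqOn hsExcessFreeEnergy F (Ico 0 η₀) → F 0 = 0 → deriv F 0 = 2 * Real.pi / 3 →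
      ∀ (β₀ θ₀ : T3 → ℝ) (u₀ : T3 → V3) (T₁ K : ℝ) (ρ₁ θ₁ : ℝ → T3 → ℝ) (u₁ : ℝ → T3 → V3),
        0 < T₁ → 0 < K → IsHardSphereEulerSolution 0 T₁ ρ₁ u₁ θ₁ →
        (∀ x, ρ₁ 0 x = β₀ x) → u₁ 0 = u₀ → θ₁ 0 = θ₀ →
        (∀ t ∈ Ico 0 T₁, ∀ x, θ₁ t x = K * ρ₁ t x ^ (2 / 3 : ℝ)) →
        (∃ C : ℝ, ∀ t ∈ Ico 0 T₁, ∀ x, ∀ i : Fin 3,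
            ‖Torus.partialDeriv i (u₁ t) x‖ ≤ C / (T₁ - t) ∧
            |Torus.partialDeriv i (fun y => ρ₁ t y ^ (1 / 3 : ℝ)) x| ≤ C / (T₁ - t)) →
        (∀ n : ℕ, n ≤ 6 → ∃ Cn pn : ℝ, ∀ t ∈ Ico 0 T₁, ∀ y : EuclideanSpace ℝ (Fin 3),
            ‖iteratedFDeriv ℝ n (Torus.lift (ρ₁ t)) y‖ ≤ Cn * (T₁ - t) ^ (-pn) ∧
            ‖iteratedFDeriv ℝ n (Torus.lift (u₁ t)) y‖ ≤ Cn * (T₁ - t) ^ (-pn)) →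
        (∃ cl pl : ℝ, 0 < cl ∧ ∀ t ∈ Ico 0 T₁, ∀ x, cl * (T₁ - t) ^ pl ≤ ρ₁ t x) →
      ∀ (ρs : ℝ → T3 → ℝ) (σ₁ : ℝ), 0 < σ₁ →
        (∀ σ : ℝ, 0 < σ → σ < σ₁ → Torus.IsSmooth (ρs σ) ∧ ∀ x, 0 < ρs σ x) →
        (∀ n : ℕ, ∃ Cn : ℝ, ∀ σ : ℝ, 0 < σ → σ < σ₁ → ∀ y : EuclideanSpace ℝ (Fin 3),
            ‖iteratedFDeriv ℝ n (Torus.lift (fun x => ρs σ x - β₀ x)) y‖ ≤ Cn * σ ^ 3) →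
      ∀ η : ℝ, 0 < η →
        ∃ e : ℝ, 0 < e ∧ ∃ σ₂ : ℝ, 0 < σ₂ ∧ σ₂ ≤ σ₁ ∧ ∀ σ : ℝ, 0 < σ → σ < σ₂ →
          σ ^ e < T₁ ∧ (∀ x, ρs σ x * σ ^ 3 ≤ η) ∧
          ∃ M : ℝ, 0 < M ∧ ∀ T : ℝ, T ≤ T₁ - σ ^ e / 2 → ∀ (ρ θ : ℝ → T3 → ℝ) (u : ℝ → T3 → V3),
            IsHardSphereEulerSolution σ T ρ u θ → ρ 0 = ρs σ → u 0 = u₀ → θ 0 = θ₀ →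
            ∀ t ∈ Ico 0 T, ∀ x,
              (M⁻¹ ≤ ρ t x ∧ ρ t x ≤ M ∧ M⁻¹ ≤ θ t x ∧ θ t x ≤ M ∧ ‖u t x‖ ≤ M ∧
                ρ t x * σ ^ 3 ≤ η ∧
                ∀ i : Fin 3, ‖Torus.partialDeriv i (u t) x‖ ≤ M ∧
                  |Torus.partialDeriv i (ρ t) x| ≤ M ∧ |Torus.partialDeriv i (θ t) x| ≤ M) ∧
              ρ₁ t x ≤ 2 * ρ t x) :
    ImplosionUnboundedDensity := by
  classical
  -- the equation of state (landed route support `HsEosLowDensity`)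
  obtain ⟨η₀, hη₀, F, hF, hEq, hF0, hF', -⟩ := hsEosLowDensity_proof
  -- the σ = 0 reference (stub 1)
  obtain ⟨a₀, θ₀, u₀, ha, hθ, hu, ha0, hθ0, T₁, K, ρ₁, θ₁, u₁, hT₁, hK, hsol₁, hρ₁0, hu₁0, hθ₁0,
    hisen, htypeI, hpoly, hlow, β, c, hβ, hc, hfloor⟩ := h1
  -- the statics (landed): identified LLN below `σ₁`, smoothness and `Cⁿ` rate of `rhoLim`
  obtain ⟨σ₁, hσ₁, Hstat⟩ := stub_staticsLLN a₀ θ₀ u₀ ha.continuous hθ.continuous hu.continuous ha0 hθ0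
  obtain ⟨hsmooth, hrate⟩ := stub_staticsSmoothRate a₀ ha ha0
  -- existence theory (stub 3) and a-priori shadowing (stub 4) at the packing target `η₁`
  obtain ⟨η₁, hη₁, Hex⟩ := h3 η₀ hη₀ F hF hEq hF0 hF'
  obtain ⟨e, he, σ₂, hσ₂, hσ₂₁, Hap⟩ :=
    h4 η₀ hη₀ F hF hEq hF0 hF' (fun x => a₀ x / ∫ y, a₀ y) θ₀ u₀ T₁ K ρ₁ θ₁ u₁
      hT₁ hK hsol₁ hρ₁0 hu₁0 hθ₁0 hisen htypeI hpoly hlow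
      (fun σ => rhoLim (profileOf a₀ ha.continuous ha0) σ) σ₁ hσ₁
      (fun σ hσ hσ' => ⟨hsmooth σ (Hstat σ hσ hσ').1, (Hstat σ hσ hσ').2.1⟩)
      (fun n => by
        obtain ⟨Cn, hCn⟩ := hrate n
        exact ⟨Cn, fun σ hσ hσ' y => hCn σ (Hstat σ hσ hσ').1 y⟩)
      η₁ hη₁
  refine ⟨a₀, θ₀, u₀, ha.continuous, hθ.continuous, hu.continuous, ha0, hθ0, fun M => ?_⟩
  -- smallness threshold: `σ^{eβ} < m := c/(2M')`, `M' := max M 1`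
  set M' : ℝ := max M 1 with hM'
  have hM'0 : 0 < M' := lt_of_lt_of_le one_pos (le_max_right _ _)
  have hMM' : M ≤ M' := le_max_left _ _
  set m : ℝ := c / (2 * M') with hm
  have hm0 : 0 < m := by positivity
  have heβ : 0 < e * β := mul_pos he hβ
  set σ₃ : ℝ := m ^ (1 / (e * β)) with hσ₃
  have hσ₃0 : 0 < σ₃ := Real.rpow_pos_of_pos hm0 _
  refine ⟨min σ₂ σ₃, lt_min hσ₂ hσ₃0, fun σ hσ0 hσlt => ?_⟩
  have hσσ₂ : σ < σ₂ := lt_of_lt_of_le hσlt (min_le_left _ _)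
  have hσσ₃ : σ < σ₃ := lt_of_lt_of_le hσlt (min_le_right _ _)
  have hσσ₁ : σ < σ₁ := hσσ₂.trans_le hσ₂₁
  obtain ⟨hσT, hpack, Mb, hMb, Hbnd⟩ := Hap σ hσ0 hσσ₂
  have hδ : 0 < σ ^ e := Real.rpow_pos_of_pos hσ0 e
  -- the horizon of classical existence and the solution with the statics data
  set T' : ℝ := T₁ - σ ^ e / 2 with hT'
  have hT'pos : 0 < T' := by rw [hT']; linarith
  obtain ⟨hsd, hpos, hLLN⟩ := Hstat σ hσ0 hσσ₁
  obtain ⟨ρ, θ, u, hsol, hρ0, hu0, hθ0'⟩ :=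
    Hex σ hσ0 (rhoLim (profileOf a₀ ha.continuous ha0) σ) θ₀ u₀ (hsmooth σ hsd) hθ hu hpos hθ0
      hpack T' Mb hT'pos hMb
      (fun T hT ρ θ u hs h₁ h₂ h₃ t ht x => (Hbnd T hT ρ θ u hs h₁ h₂ h₃ t ht x).1)
  refine ⟨T', ρ, θ, u, hsol,
    fun Φ => (tendstoHydroFieldsAt_congr_slice hρ0 hu0 hθ0').2 (hLLN Φ), ?_⟩
  -- density at the exit time `tₑ := T₁ - σ^e`
  set tₑ : ℝ := T₁ - σ ^ e with htₑ
  have htₑ0 : 0 ≤ tₑ := by rw [htₑ]; linarith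
  have htₑT : tₑ < T' := by rw [htₑ, hT']; linarith
  have htₑ1 : tₑ ∈ Ico 0 T₁ := ⟨htₑ0, by rw [htₑ]; linarith⟩
  obtain ⟨x, hx⟩ := hfloor tₑ htₑ1
  refine ⟨tₑ, ⟨htₑ0, htₑT⟩, x, ?_⟩
  have hclose : ρ₁ tₑ x ≤ 2 * ρ tₑ x :=
    (Hbnd T' le_rfl ρ θ u hsol hρ0 hu0 hθ0' tₑ ⟨htₑ0, htₑT⟩ x).2
  -- the reference floor at the exit time: `c * σ ^ (e * -β) ≤ ρ₁ tₑ x`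
  have hTt : T₁ - tₑ = σ ^ e := by rw [htₑ]; ring
  rw [hTt, ← Real.rpow_mul hσ0.le] at hx
  -- `σ ^ (e β) < m`, so `c * σ ^ (-(eβ)) > c / m = 2 M'`
  have hA : 0 < σ ^ (e * β) := Real.rpow_pos_of_pos hσ0 _
  have hsmall : σ ^ (e * β) < m := by
    have h₁ : σ ^ (e * β) < σ₃ ^ (e * β) := Real.rpow_lt_rpow hσ0.le hσσ₃ heβ
    have h₂ : σ₃ ^ (e * β) = m := by
      rw [hσ₃, ← Real.rpow_mul hm0.le]
      have : 1 / (e * β) * (e * β) = 1 := by field_simp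
      rw [this, Real.rpow_one]
    exact h₁.trans_eq h₂
  have hneg : σ ^ (e * -β) = (σ ^ (e * β))⁻¹ := by
    rw [show e * -β = -(e * β) by ring, Real.rpow_neg hσ0.le]
  have hkey : 2 * M' < c * σ ^ (e * -β) := by
    rw [hneg, ← div_eq_mul_inv, lt_div_iff₀ hA]
    calc 2 * M' * σ ^ (e * β) < 2 * M' * m := mul_lt_mul_of_pos_left hsmall (by positivity)
      _ = c := by rw [hm]; field_simp
  linarith

/-! ## The closing theorems, conditional on the vendored named facts -/

/-- `IdealGasImplosion → hsEuler_continuousDependence → ImplosionUnboundedDensity`: the planner's glue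
`implosionUnboundedDensity_of` with `EosContinuity` supplied by the tree's conditional closing
`eosContinuity_proof` (named fact `hsEuler_continuousDependence`, Kato 1975 Thm III). [folklore] -/
theorem implosionUnboundedDensity_of_idealGasImplosion_of_continuousDependence
    (hI : IdealGasImplosion) (hdep : hsEuler_continuousDependence) : ImplosionUnboundedDensity :=
  implosionUnboundedDensity_of hI (eosContinuity_proof hdep)

/-- **`ImplosionDichotomy.ImplosionUnboundedDensity`** (route support stmt-AtomisticToContinuum-12590),
CLOSED MODULO the two named Literature facts that carry its entire mathematical content: the smooth
periodic implosion of the monatomic ideal gas (`Literature.Analysis.FluidPDE.CaolaboraEtAl2025_thm12_euler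
(5/3)`, Cao-Labora–Gómez-Serrano–Shi–Staffilani Thm 1.2 + Rem 1.4–1.5, `γ = 5/3` profile) and Kato's
continuous dependence of classical hard-sphere Euler solutions on the data and on the reduced diameter at
the ideal-gas end (`Literature.MathematicalPhysics.KineticTheory.hsEuler_continuousDependence`, Kato 1975
Thm III / Majda 1984 Thms 2.1–2.2); statics, equation of state, small-packing uniqueness and the glue are
proved in the tree. Trust base: these two names. [cite: CaolaboraEtAl2025, Thm 1.2 + Rem 1.4 + Rem 1.5] -/
theorem implosionUnboundedDensity_proof
    (hfact : Literature.Analysis.FluidPDE.CaolaboraEtAl2025_thm12_euler (5 / 3))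
    (hdep : hsEuler_continuousDependence) : ImplosionUnboundedDensity :=
  implosionUnboundedDensity_of_thm12 hfact (eosContinuity_proof hdep)

end Summit.AtomisticToContinuum.HydrodynamicLimit.Theorems
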